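import Summits.QuantumFields.BalabanUV.Beta.EriceRemainderEnclosureHistoryAutonomyComparisonAgeCompositionAdaptiveLevels
import Summits.QuantumFields.BalabanUV.Beta.EriceRemainderEnclosureHistoryAutonomyComparisonAgeCompositionOldBlockCapWider
import Summits.QuantumFields.BalabanUV.Beta.EriceRemainderEnclosureHistoryAutonomyComparisonAgeCompositionOldBlockCapSpan3
import Summits.QuantumFields.BalabanUV.Beta.EriceRemainderEnclosureHistoryAutonomyComparisonAgeCompositionTwoClusterLevels
import Summits.QuantumFields.BalabanUV.Beta.EriceRemainderEnclosureHistoryAutonomyComparisonAgeCompositionAdaptiveFourAgesBoxes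

/-!
# EriceRemainderEnclosureHistoryAutonomyComparisonAgeCompositionAdaptiveFourAges — (E101e) route (N), first order: THE CENSUS FOUR AGES AT EVERY TOP
# RATIO.  Gens 85–87 typed the census four ages `{1,k₂,k₃,k₄}` only when the top ratio `k₄∕k₃` is `≤ 2` (near pair, (E99f)∕(E99g); `≤ 4` with the double
# octave of (E100f)) or `≥ 61` (the uniform chain (E97c)); `2 < k₄∕k₃ < 61` was «the cascade's ratio, not the cap's» (README g87 §4(3)).  The ADAPTIVE
# cascade (E101a)∕(E101b) dissolves it: levels `{1,k₂}` (cap `0.8333`, (E97c)), `{k₃}`, `{k₄}` (single caps `0.6142`, (E94b)) with overshoots `κ₂ = 0`,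
# `κ₁(q) = 4k₃X₂(q)∕(k₄(1 − X₂(q)))` (the top level's closure with EQUALITY, `X₂ = x_{k₄}`), `κ₀ = 1∕5`; the middle closure
# `k₂(4X₁(1+κ₁) + κ₁) ≤ (1∕5)(1 − X₁(1+κ₁))k₃` at `k₃ ≥ 61k₂` is a two-variable inequality on the polytope `X₁, X₂ ≤ 0.6142`, `X₁ + X₂ ≤ V(F)` whose
# joint cap `V(F)` tightens as the top ratio `F = k₄∕k₃` shrinks — exactly what the argmax tables deliver: `13∕20` (span 3, (E100g)), `11∕16` (4, (E100e)),
# `77∕100` (8), `89∕100` (16), `21∕20` (32, (E101c)), none beyond 32.  Certificate (`HOME/b2b-balaban-beta-d4-p2/g88/numerics/four_cert.py` →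
# `four_cert.json`, exact): per bracket `F ∈ (2,3] ∕ (3,4] ∕ (4,8] ∕ (8,16] ∕ (16,32] ∕ (32,∞)` a cover of `X₂ ∈ [0, 0.6142]` by `14 ∕ 7 ∕ 11 ∕ 6 ∕ 4 ∕ 1`
# sub-boxes, each a monotone corner check ((E101d) `…AdaptiveFourAgesBoxes`).  RESULT: **`flow_nonneg_census_four_ages_adaptive`** (`2 ≤ k₂ ≤ 29`,
# `61k₂ ≤ k₃`, `2k₃ < k₄ < K`) and, with (E99g) `flow_nonneg_census_four_ages_near_old_pair_gap33` for `k₄ ≤ 2k₃`, **`flow_nonneg_census_four_ages_all`**: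
# the census four ages `{1, k₂, k₃, k₄}` hold along every admissible flow, every horizon, every damping of the self-consistent class, for `2 ≤ k₂ ≤ 29`,
# `61k₂ ≤ k₃` and EVERY `k₄ > k₃` — the region `2 < k₄∕k₃ < 61` is closed.

Cell `pub-balaban`, β-function sub-cell, BINDER row D4 «RemainderConst leaves for Bałaban's split» (`HOME/BINDER-OWNERS.md`; owner lineage `b2b-balaban-beta-an4`;
this file by co-owner #2 lineage `b2b-balaban-beta-d4-p2`, generation 88), β-FLOW TEAM duty (1), FREEZE (0) honoured (def-free; nothing restated).

HONEST FRAMING (page 1, verbatim and binding).  *"Discharging BetaPertH makes Bałaban's UV stability UNCONDITIONAL — a real constructive-QFT result; it is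
NOT the continuum limit and NOT the Clay problem."*  THIS FILE DISCHARGES NOTHING OF THE KIND.  Elementary real algebra ∕ real analysis about ABSTRACT
functionals on a box ]0,γ]^ℕ with displayed floors, profiles and signs, and the FIRST-ORDER renewal objects of route (N) built from them — hypotheses of a
census, not facts; the form, signs, ages and moments of Bałaban's (1.22) limit functional are NOT PRINTED ([I] p. 298; GAPS G-t4-U2-1∕-2) and NOT asserted.
Row D4 class UNCHANGED (critical-path width 0; instance 0∕1; D4 DISCHARGE NO DATE).  HONEST DEPENDENCY: continuum YM on T⁴ ⇐ BetaPertH ∧ nine spine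
estimates (0/9 proved); BetaPertH ⇐ (D1) ∧ (D4) ∧ CAP+tail; G-an2-4 gates asym, D1 and NE2/3/4.

THE POINT (README `HOME/b2b-balaban-beta-d4-p2/g88/README.md` §5; `numerics/adaptive1.py`–`adaptive3.py`): the allowed joint cap at `k₃ ≥ 61k₂` is
`0.677 ∕ 0.748 ∕ 0.785 ∕ 0.906 ∕ 1.066 ∕ 1.228` at `F = 2 ∕ 3 ∕ 4 ∕ 8 ∕ 16 ∕ 32` (monotone in `F`), against the typed `0.65 ∕ 0.6875 ∕ 0.77 ∕ 0.89 ∕ 1.05 ∕ 1.2284`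
on the brackets above them.  Uses (E101b) `flow_nonneg_adaptive_cluster_levels`, (E100g) `old_block_load_le_span3`, (E100e) `old_block_load_le_span4`, (E101c)
`old_block_load_le_span8∕16∕32`, (E101d) `middle_closure_bracket*`, (E97c) `young_pair_load_le`, (E94b) `load_le_of_sq`, (E99g)
`flow_nonneg_census_four_ages_near_old_pair_gap33` BY NAME.  NOT
CLAIMED: `k₂ ≥ 30` (young-pair rows untyped); `k₃ < 61k₂`; five or more ages; anything printed — NOT B12 Thm 2, NOT BetaPertH, NOT continuum, NOT Clay.

WHAT IS PROVED ([folklore]; 0 `def`, 0 sorry).  §1 **`flow_nonneg_census_four_ages_adaptive`**.  §2 **`flow_nonneg_census_four_ages_all`**.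
-/
noncomputable section
open Finset

namespace Summit.QuantumFields.BalabanUV.Beta.EriceRemainderEnclosureHistoryAutonomyComparisonAgeCompositionAdaptiveFourAges

open Literature.MathematicalPhysics.QuantumFieldTheory.Balaban1983to89
open Literature.MathematicalPhysics.QuantumFieldTheory.Balaban1983to89.T4BetaStationary
open Literature.MathematicalPhysics.QuantumFieldTheory.Balaban1983to89.T4BetaFlowWellPosed
open Summit.QuantumFields.BalabanUV.Beta.EriceRemainderEnclosureHistoryAutonomyComparisonAgeCompositionYoungPairMoment (load_le_of_sq)
open Summit.QuantumFields.BalabanUV.Beta.EriceRemainderEnclosureHistoryAutonomyComparisonAgeCompositionYoungPairCapSeparatedAges (young_pair_load_le)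
open Summit.QuantumFields.BalabanUV.Beta.EriceRemainderEnclosureHistoryAutonomyComparisonAgeCompositionAdaptiveLevels (flow_nonneg_adaptive_cluster_levels)
open Summit.QuantumFields.BalabanUV.Beta.EriceRemainderEnclosureHistoryAutonomyComparisonAgeCompositionOldBlockCapSpan3 (old_block_load_le_span3)
open Summit.QuantumFields.BalabanUV.Beta.EriceRemainderEnclosureHistoryAutonomyComparisonAgeCompositionOldBlockCapWide (old_block_load_le_span4)
open Summit.QuantumFields.BalabanUV.Beta.EriceRemainderEnclosureHistoryAutonomyComparisonAgeCompositionOldBlockCapWider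
  (old_block_load_le_span8 old_block_load_le_span16 old_block_load_le_span32)
open Summit.QuantumFields.BalabanUV.Beta.EriceRemainderEnclosureHistoryAutonomyComparisonAgeCompositionTwoClusterLevels
  (flow_nonneg_census_four_ages_near_old_pair_gap33)
open Summit.QuantumFields.BalabanUV.Beta.EriceRemainderEnclosureHistoryAutonomyComparisonAgeCompositionAdaptiveFourAgesBoxes

variable {B : (ℕ → ℝ) → ℝ} {γ b gIR : ℝ} {L : ℕ → ℝ} {K : ℕ} {h g : ℕ → ℝ}

/-! ## §1 The census four ages with the top two as separate adaptive levels -/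

/-- **THE CENSUS FOUR AGES `{1, k₂, k₃, k₄}`, `2 ≤ k₂ ≤ 29`, `61k₂ ≤ k₃`, `2k₃ < k₄`: EVERY TOP RATIO ABOVE 2.**  Profile carried by `{1,k₂,k₃,k₄}`
(`k₄ < K`): `0 ≤ ε ≤ e` at every pin, every horizon, every damping of the self-consistent class — (E101b) `flow_nonneg_adaptive_cluster_levels` with
`S = ({1,k₂}, {k₃}, {k₄})`, `κ = (1∕5, 4k₃x_{k₄}(q)∕(k₄(1 − x_{k₄}(q))), 0)`; the top closure holds with equality, the young one by (E97c)
`young_pair_load_le` (`0.8333·6∕5 ≤ 1`), the middle one by `level_one_closure_of_box` on the bracket of `k₄∕k₃` with the joint cap of that span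
((E100g) `13∕20`, (E100e) `11∕16`, (E101c) `77∕100`, `89∕100`, `21∕20`; none beyond 32) and the sub-box of `x_{k₄}(q)`. [folklore] -/
theorem flow_nonneg_census_four_ages_adaptive
    (hmono : ∀ u v : ℕ → ℝ, SeqBox γ u → SeqBox γ v → (∀ j, u j ≤ v j) → B u ≤ B v)
    (hL : ∀ k, 0 ≤ L k) (hb : 0 < b) (hlo : ∀ u, SeqBox γ u → b ≤ B u) (hdom : ∀ u, SeqBox γ u → ∑ k ∈ range K, L k * u k ≤ B u)
    (hh : SeqBox γ h) (hf : MemFlow B gIR h) (hg : ∀ t, 0 < g t ∧ g t ≤ 1)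
    (hgF : ∀ t, 1 ≤ g t * (1 + ∑ k ∈ range K, L k * h (t + k) ^ 3 / 2))
    {k₂ k₃ k₄ : ℕ} (hk2 : 2 ≤ k₂) (hk29 : k₂ ≤ 29) (hk3 : 61 * k₂ ≤ k₃) (hk34 : 2 * k₃ < k₄) (hk4K : k₄ < K)
    (hLa : ∀ l, l < K → l ≠ 1 → l ≠ k₂ → l ≠ k₃ → l ≠ k₄ → L l = 0)
    {N : ℕ} {KL : ℕ → ℕ → ℕ → ℝ}
    (hKL : ∀ k n l, KL k n l = if 0 < k ∧ k < K ∧ l < k then L k * h (n + k) ^ 3 / 2 * ∏ t ∈ Ico (n + 1 + l) (n + k + 1), g t else 0)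
    {KA : ℕ → ℕ → ℕ → ℝ} {RA : ℕ → (ℕ → ℝ) → ℕ → ℝ}
    (hRA : ∀ i v m, RA i v m = ∑ l ∈ range K, KA i m l * v (m + 1 + l))
    (hKA : ∀ i m l, KA i m l = KL i m l + KA (i + 1) m l) (hKAtop : ∀ m l, KA K m l = 0)
    {e ε : ℕ → ℝ} (he0 : ∀ m, 0 ≤ e m) (hea : ∀ m, e (m + 1) ≤ e m)
    (hεt : ∀ m, N < m → ε m = 0) (hεrec : ∀ m, ε m = e m - RA 1 ε m) : ∀ m, 0 ≤ ε m ∧ ε m ≤ e m := by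
  have hpos : ∀ n, 0 < h n := fun n => (hh n).1
  have hk3pos : (0 : ℝ) < k₃ := by exact_mod_cast (show 0 < k₃ by omega)
  have hk4pos : (0 : ℝ) < k₄ := by exact_mod_cast (show 0 < k₄ by omega)
  have hρ : (61 : ℝ) * k₂ ≤ k₃ := by exact_mod_cast hk3
  -- the two old loads and their single caps (E94b) (`8k·0.6142² ≥ 3k+1` from `k ≥ 56`)
  obtain ⟨X₁, hX₁⟩ : ∃ X₁ : ℕ → ℝ, ∀ q, X₁ q = (k₃ : ℝ) * (L k₃ * h (q + k₃) ^ 3 / 2) := ⟨_, fun _ => rfl⟩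
  obtain ⟨X₂, hX₂⟩ : ∃ X₂ : ℕ → ℝ, ∀ q, X₂ q = (k₄ : ℝ) * (L k₄ * h (q + k₄) ^ 3 / 2) := ⟨_, fun _ => rfl⟩
  have hX1c : ∀ q, 0 ≤ X₁ q ∧ X₁ q ≤ 3071 / 5000 := fun q => by
    refine ⟨by rw [hX₁]; have := hL k₃; have := hpos (q + k₃); positivity, ?_⟩
    rw [hX₁]
    have hr : (56 : ℝ) ≤ k₃ := by exact_mod_cast (show 56 ≤ k₃ by omega)
    exact load_le_of_sq hmono hL hb hlo hdom hh hf (by omega) (by omega) (so := 3071 / 5000) (by norm_num) (by nlinarith) q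
  have hX2c : ∀ q, 0 ≤ X₂ q ∧ X₂ q ≤ 3071 / 5000 := fun q => by
    refine ⟨by rw [hX₂]; have := hL k₄; have := hpos (q + k₄); positivity, ?_⟩
    rw [hX₂]
    have hr : (56 : ℝ) ≤ k₄ := by exact_mod_cast (show 56 ≤ k₄ by omega)
    exact load_le_of_sq hmono hL hb hlo hdom hh hf (by omega) hk4K (so := 3071 / 5000) (by norm_num) (by nlinarith) q
  -- the levels and the overshoots
  obtain ⟨S, hS⟩ : ∃ S : ℕ → Finset ℕ, ∀ j, S j = if j = 0 then {1, k₂} else if j = 1 then {k₃} else {k₄} := ⟨_, fun _ => rfl⟩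
  obtain ⟨LO, hLO⟩ : ∃ LO : ℕ → ℕ, ∀ j, LO j = if j = 0 then 1 else if j = 1 then k₃ else k₄ := ⟨_, fun _ => rfl⟩
  obtain ⟨HI, hHI⟩ : ∃ HI : ℕ → ℕ, ∀ j, HI j = if j = 0 then k₂ else if j = 1 then k₃ else k₄ := ⟨_, fun _ => rfl⟩
  obtain ⟨κ, hκ⟩ : ∃ κ : ℕ → ℕ → ℝ, ∀ j q, κ j q = if j = 0 then 1 / 5 else if j = 1 then 4 * k₃ * X₂ q / (k₄ * (1 - X₂ q)) else 0 :=
    ⟨_, fun _ _ => rfl⟩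
  have hS0 : S 0 = {1, k₂} := by rw [hS]; simp
  have hS1 : S 1 = {k₃} := by rw [hS]; simp
  have hS2 : S 2 = {k₄} := by rw [hS]; simp
  have hLO0 : LO 0 = 1 := by rw [hLO]; simp
  have hLO1 : LO 1 = k₃ := by rw [hLO]; simp
  have hLO2 : LO 2 = k₄ := by rw [hLO]; simp
  have hHI0 : HI 0 = k₂ := by rw [hHI]; simp
  have hHI1 : HI 1 = k₃ := by rw [hHI]; simp
  have hHI2 : HI 2 = k₄ := by rw [hHI]; simp
  have hκ0v : ∀ q, κ 0 q = 1 / 5 := fun q => by rw [hκ]; simp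
  have hκ1v : ∀ q, κ 1 q = 4 * k₃ * X₂ q / (k₄ * (1 - X₂ q)) := fun q => by rw [hκ]; simp
  have hκ2v : ∀ q, κ 2 q = 0 := fun q => by rw [hκ]; simp
  have hden : ∀ q, 0 < (k₄ : ℝ) * (1 - X₂ q) := fun q => mul_pos hk4pos (by linarith [(hX2c q).2])
  have hκ1nn' : ∀ q, 0 ≤ κ 1 q := fun q => by
    rw [hκ1v]; exact div_nonneg (by have := (hX2c q).1; positivity) (hden q).le
  have hκeq : ∀ q, κ 1 q * ((k₄ : ℝ) * (1 - X₂ q)) = 4 * (k₃ : ℝ) * X₂ q := fun q => by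
    rw [hκ1v, div_mul_cancel₀ _ (ne_of_gt (hden q))]
  refine flow_nonneg_adaptive_cluster_levels hmono hL hb hlo hdom hh hf hg hgF (by omega) (r := 3) (S := S) (lo := LO) (hi := HI) (κ := κ)
    (fun j q => ?_) (fun j hj k hk => ?_) (fun j hj k hk => ?_) (fun j hj k hk => ?_) (fun j hj1 hjr => ?_) (fun j hj1 hjr => ?_)
    (fun j hj => ?_) (fun i j hij hjr => ?_) (fun l hl hno => ?_) (fun q => ?_) (fun j q hj1 hjr => ?_) hKL hRA hKA hKAtop he0 hea hεt hεrec
  · -- overshoots are non-negative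
    rcases Nat.lt_or_ge j 3 with hj | hj
    · interval_cases j
      · rw [hκ0v]; norm_num
      · exact hκ1nn' q
      · rw [hκ2v]
    · rw [hκ, if_neg (by omega), if_neg (by omega)]
  · -- members are ages in [1, K)
    interval_cases j
    · rw [hS0, mem_insert, mem_singleton] at hk; rcases hk with rfl | rfl <;> omega
    · rw [hS1, mem_singleton] at hk; omega
    · rw [hS2, mem_singleton] at hk; omega
  · -- members are ≥ lo
    interval_cases j
    · rw [hS0, mem_insert, mem_singleton] at hk; rw [hLO0]; rcases hk with rfl | rfl <;> omega
    · rw [hS1, mem_singleton] at hk; rw [hLO1]; omega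
    · rw [hS2, mem_singleton] at hk; rw [hLO2]; omega
  · -- members are ≤ hi
    interval_cases j
    · rw [hS0, mem_insert, mem_singleton] at hk; rw [hHI0]; rcases hk with rfl | rfl <;> omega
    · rw [hS1, mem_singleton] at hk; rw [hHI1]; omega
    · rw [hS2, mem_singleton] at hk; rw [hHI2]; omega
  · -- lo ≤ hi
    interval_cases j
    · rw [hLO1, hHI1]
    · rw [hLO2, hHI2]
  · -- 1 ≤ lo
    interval_cases j
    · rw [hLO1]; omega
    · rw [hLO2]; omega
  · -- nested
    have : j = 0 ∨ j = 1 := by omega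
    rcases this with rfl | rfl
    · rw [hHI0, hLO1]; omega
    · rw [hHI1, hLO2]; omega
  · -- pairwise disjoint
    have : (i = 0 ∧ j = 1) ∨ (i = 0 ∧ j = 2) ∨ (i = 1 ∧ j = 2) := by omega
    rcases this with ⟨rfl, rfl⟩ | ⟨rfl, rfl⟩ | ⟨rfl, rfl⟩
    · rw [hS0, hS1, disjoint_singleton_right, mem_insert, mem_singleton]; omega
    · rw [hS0, hS2, disjoint_singleton_right, mem_insert, mem_singleton]; omega
    · rw [hS1, hS2, disjoint_singleton_right, mem_singleton]; omega
  · -- the profile vanishes off the four ages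
    have h0 := hno 0 (by omega); have h1 := hno 1 (by omega); have h2 := hno 2 (by omega)
    rw [hS0, mem_insert, mem_singleton, not_or] at h0
    rw [hS1, mem_singleton] at h1
    rw [hS2, mem_singleton] at h2
    exact hLa l hl h0.1 h0.2 h1 h2
  · -- the young pair's closure: 0.8333·(1 + 1∕5) ≤ 1
    rw [hS0, hκ0v, sum_pair (show (1 : ℕ) ≠ k₂ by omega), Nat.cast_one, one_mul]
    have := young_pair_load_le hmono hL hb hlo hdom hh hf hk2 hk29 (by omega) q
    nlinarith
  · -- the two old levels
    have : j = 1 ∨ j = 2 := by omega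
    rcases this with rfl | rfl
    · -- THE MIDDLE CLOSURE: bracket of k₄∕k₃, joint cap of the span, sub-boxes of X₂ (the pure bracket lemmas)
      rw [hS1, sum_singleton, show (1 : ℕ) - 1 = 0 from rfl, hHI0, hLO1, hκ0v, ← hX₁]
      have h1c := hX1c q
      have h2c := hX2c q
      rcases le_or_gt k₄ (3 * k₃) with hbr0 | hbr0
      · have hj : X₁ q + X₂ q ≤ 13 / 20 := by
          have := old_block_load_le_span3 hmono hL hb hlo hdom hh hf (S := {k₃, k₄}) (lo := k₃) (hi := k₄) (by omega) (by omega) hk4K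
            (fun k hk => by simp only [mem_insert, mem_singleton] at hk; rcases hk with rfl | rfl <;> omega) q
          rwa [sum_pair (show k₃ ≠ k₄ by omega), ← hX₁, ← hX₂] at this
        exact middle_closure_bracket3 h1c.1 h1c.2 h2c.2 hj (by exact_mod_cast (show 2 * k₃ ≤ k₄ by omega)) hρ hk3pos (hκ1nn' q) (hκeq q)
      rcases le_or_gt k₄ (4 * k₃) with hbr1 | hbr1
      · have hj : X₁ q + X₂ q ≤ 11 / 16 := by
          have := old_block_load_le_span4 hmono hL hb hlo hdom hh hf (S := {k₃, k₄}) (lo := k₃) (hi := k₄) (by omega) (by omega) hk4K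
            (fun k hk => by simp only [mem_insert, mem_singleton] at hk; rcases hk with rfl | rfl <;> omega) q
          rwa [sum_pair (show k₃ ≠ k₄ by omega), ← hX₁, ← hX₂] at this
        exact middle_closure_bracket4 h1c.1 h1c.2 h2c.2 hj (by exact_mod_cast (show 3 * k₃ ≤ k₄ by omega)) hρ hk3pos (hκ1nn' q) (hκeq q)
      rcases le_or_gt k₄ (8 * k₃) with hbr2 | hbr2
      · have hj : X₁ q + X₂ q ≤ 77 / 100 := by
          have := old_block_load_le_span8 hmono hL hb hlo hdom hh hf (S := {k₃, k₄}) (lo := k₃) (hi := k₄) (by omega) (by omega) hk4K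
            (fun k hk => by simp only [mem_insert, mem_singleton] at hk; rcases hk with rfl | rfl <;> omega) q
          rwa [sum_pair (show k₃ ≠ k₄ by omega), ← hX₁, ← hX₂] at this
        exact middle_closure_bracket8 h1c.1 h1c.2 h2c.2 hj (by exact_mod_cast (show 4 * k₃ ≤ k₄ by omega)) hρ hk3pos (hκ1nn' q) (hκeq q)
      rcases le_or_gt k₄ (16 * k₃) with hbr3 | hbr3
      · have hj : X₁ q + X₂ q ≤ 89 / 100 := by
          have := old_block_load_le_span16 hmono hL hb hlo hdom hh hf (S := {k₃, k₄}) (lo := k₃) (hi := k₄) (by omega) (by omega) hk4K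
            (fun k hk => by simp only [mem_insert, mem_singleton] at hk; rcases hk with rfl | rfl <;> omega) q
          rwa [sum_pair (show k₃ ≠ k₄ by omega), ← hX₁, ← hX₂] at this
        exact middle_closure_bracket16 h1c.1 h1c.2 h2c.2 hj (by exact_mod_cast (show 8 * k₃ ≤ k₄ by omega)) hρ hk3pos (hκ1nn' q) (hκeq q)
      rcases le_or_gt k₄ (32 * k₃) with hbr4 | hbr4
      · have hj : X₁ q + X₂ q ≤ 21 / 20 := by
          have := old_block_load_le_span32 hmono hL hb hlo hdom hh hf (S := {k₃, k₄}) (lo := k₃) (hi := k₄) (by omega) (by omega) hk4K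
            (fun k hk => by simp only [mem_insert, mem_singleton] at hk; rcases hk with rfl | rfl <;> omega) q
          rwa [sum_pair (show k₃ ≠ k₄ by omega), ← hX₁, ← hX₂] at this
        exact middle_closure_bracket32 h1c.1 h1c.2 h2c.2 hj (by exact_mod_cast (show 16 * k₃ ≤ k₄ by omega)) hρ hk3pos (hκ1nn' q) (hκeq q)
      exact middle_closure_bracketTop h1c.1 h1c.2 h2c.2 (by exact_mod_cast (show 32 * k₃ ≤ k₄ by omega)) hρ hk3pos (hκ1nn' q) (hκeq q)
    · -- the top closure: equality by the choice of κ₁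
      rw [hS2, sum_singleton, show (2 : ℕ) - 1 = 1 from rfl, hHI1, hLO2, hκ2v, ← hX₂]
      refine ⟨by linarith [(hX2c q).2], ?_⟩
      have e1 : κ 1 q * (1 - X₂ q * (1 + 0)) * (k₄ : ℝ) = κ 1 q * ((k₄ : ℝ) * (1 - X₂ q)) := by ring
      rw [e1, hκeq q]
      apply le_of_eq; ring

/-! ## §2 Every top ratio -/

/-- **THE CENSUS FOUR AGES `{1, k₂, k₃, k₄}` FOR `2 ≤ k₂ ≤ 29`, `61k₂ ≤ k₃` AND EVERY `k₄ > k₃`.**  `0 ≤ ε ≤ e` at every pin, every horizon, every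
damping of the self-consistent class: `k₄ ≤ 2k₃` by (E99g) `flow_nonneg_census_four_ages_near_old_pair_gap33` (the near pair `{k₃,k₄}` as ONE level at
gap `33k₂ ≤ k₃`), `k₄ > 2k₃` by `flow_nonneg_census_four_ages_adaptive`.  The open region `2 < k₄∕k₃ < 61` of README g87 §4(3) is closed. [folklore] -/
theorem flow_nonneg_census_four_ages_all
    (hmono : ∀ u v : ℕ → ℝ, SeqBox γ u → SeqBox γ v → (∀ j, u j ≤ v j) → B u ≤ B v)
    (hL : ∀ k, 0 ≤ L k) (hb : 0 < b) (hlo : ∀ u, SeqBox γ u → b ≤ B u) (hdom : ∀ u, SeqBox γ u → ∑ k ∈ range K, L k * u k ≤ B u)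
    (hh : SeqBox γ h) (hf : MemFlow B gIR h) (hg : ∀ t, 0 < g t ∧ g t ≤ 1)
    (hgF : ∀ t, 1 ≤ g t * (1 + ∑ k ∈ range K, L k * h (t + k) ^ 3 / 2))
    {k₂ k₃ k₄ : ℕ} (hk2 : 2 ≤ k₂) (hk29 : k₂ ≤ 29) (hk3 : 61 * k₂ ≤ k₃) (hk34 : k₃ < k₄) (hk4K : k₄ < K)
    (hLa : ∀ l, l < K → l ≠ 1 → l ≠ k₂ → l ≠ k₃ → l ≠ k₄ → L l = 0)
    {N : ℕ} {KL : ℕ → ℕ → ℕ → ℝ}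
    (hKL : ∀ k n l, KL k n l = if 0 < k ∧ k < K ∧ l < k then L k * h (n + k) ^ 3 / 2 * ∏ t ∈ Ico (n + 1 + l) (n + k + 1), g t else 0)
    {KA : ℕ → ℕ → ℕ → ℝ} {RA : ℕ → (ℕ → ℝ) → ℕ → ℝ}
    (hRA : ∀ i v m, RA i v m = ∑ l ∈ range K, KA i m l * v (m + 1 + l))
    (hKA : ∀ i m l, KA i m l = KL i m l + KA (i + 1) m l) (hKAtop : ∀ m l, KA K m l = 0)
    {e ε : ℕ → ℝ} (he0 : ∀ m, 0 ≤ e m) (hea : ∀ m, e (m + 1) ≤ e m)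
    (hεt : ∀ m, N < m → ε m = 0) (hεrec : ∀ m, ε m = e m - RA 1 ε m) : ∀ m, 0 ≤ ε m ∧ ε m ≤ e m := by
  rcases le_or_gt k₄ (2 * k₃) with hnear | hfar
  · exact flow_nonneg_census_four_ages_near_old_pair_gap33 hmono hL hb hlo hdom hh hf hg hgF hk2 hk29 (by omega) hk34 hnear hk4K hLa hKL hRA hKA
      hKAtop he0 hea hεt hεrec
  · exact flow_nonneg_census_four_ages_adaptive hmono hL hb hlo hdom hh hf hg hgF hk2 hk29 hk3 hfar hk4K hLa hKL hRA hKA hKAtop he0 hea hεt hεrec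

end Summit.QuantumFields.BalabanUV.Beta.EriceRemainderEnclosureHistoryAutonomyComparisonAgeCompositionAdaptiveFourAges
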